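import Literature.NumberTheory.LFunctions.CardonRobertsOrthogonalPolynomials
import HarnessLib

/-!
# RH-FREE · Orthogonality, uniqueness and parity of the Cardon–Roberts Gram–Schmidt polynomials `cardonRobertsPoly μ n` for a general measure `μ` — nothing here bears on the truth of RH

Literature-typing tranche `rh-lit-broughan-2` (Broughan, *Equivalents of the Riemann Hypothesis*
Vol. 2, Ch. 6 "Orthogonal Polynomials", §§6.2–6.3; Cardon–Roberts, J. Approx. Theory 138 (2006)
§2 "A few facts about orthogonal polynomials"). This file is the first, purely algebraic layer of
the proof of the tree's named fact `CardonRoberts2006_lemma_3_5` (Broughan Thm 6.16): it develops,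
for an ARBITRARY measure `μ` on `ℝ` all of whose moments exist and which is not carried by the
zero set of a non-zero polynomial, the standard facts about the monic Gram–Schmidt polynomials
`p_n = cardonRobertsPoly μ n` of the tree file `CardonRobertsOrthogonalPolynomials`:

* `CardonRobertsOP.integrable_eval` — every polynomial is `μ`-integrable (CR Lemma 3.1, first half);
* bilinearity / symmetry of `⟨p, q⟩ = ∫ p q dμ = cardonRobertsInner μ p q`, and
  `CardonRobertsOP.inner_self_pos`: `⟨p, p⟩ > 0` for `p ≠ 0` (CR Lemma 3.1, second half: "Because
  the measure `dF` has infinite support `⟨p(x), p(x)⟩ > 0` unless `p(x) = 0`"); more generally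
  `CardonRobertsOP.integral_pos_of_nonneg_ae`: a non-zero polynomial which is `≥ 0` `μ`-a.e. has
  positive integral;
* `CardonRobertsOP.monic`, `natDegree_eq`, `degree_eq` — `p_n` is monic of degree `n`;
* `CardonRobertsOP.inner_eq_zero_of_lt` (`⟨p_n, p_k⟩ = 0`, `k < n`), `inner_eq_zero_of_degree_lt`
  (`⟨p_n, q⟩ = 0` whenever `deg q < n`), `eq_of_monic_of_orthogonal` (uniqueness: a monic
  polynomial of degree `n` orthogonal to all polynomials of lower degree is `p_n`);
* `CardonRobertsOP.comp_neg_X`, `eval_neg` — for a measure symmetric under `x ↦ −x`,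
  `p_n(−x) = (−1)ⁿ p_n(x)` ("`p_{2n}(x)` is an even function while `p_{2n+1}(x)` is an odd
  function", CR p. 55 / p. 60).

Hypotheses are carried explicitly (no structure, no instance):
`hmom : ∀ m, Integrable (fun x ↦ x ^ m) μ` (all moments exist) and
`hae : ∀ p : ℝ[X], (fun x ↦ p.eval x) =ᵐ[μ] 0 → p = 0` (no non-zero polynomial vanishes
`μ`-a.e., i.e. `μ` is not supported on finitely many points — CR: "`S(ψ)` is infinite"), and for
parity `hsym : ∀ p : ℝ[X], ∫ p(−x) dμ = ∫ p(x) dμ`.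

No new definitions, no named facts (D-0026); standard axioms only. Nothing here is specific to
`ζ`; nothing here bears on the truth of RH.

## References

* [CardonRoberts2006] D. A. Cardon, S. A. Roberts, *An equivalence for the Riemann Hypothesis in
  terms of orthogonal polynomials*, J. Approx. Theory 138 (2006) 54–64, §2 (Gram–Schmidt p. 56),
  Lemma 3.1 p. 58.
* [Broughan2017] K. Broughan, *Equivalents of the Riemann Hypothesis* Vol. 2, CUP 2017, §§6.2–6.3.
* G. Szegő, *Orthogonal Polynomials*, AMS Colloq. Publ. 23, §2.2 (existence and uniqueness of the
  orthogonal polynomials of a distribution).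
-/

noncomputable section

open MeasureTheory Polynomial Filter

namespace Literature.NumberTheory.LFunctions

namespace CardonRobertsOP

variable {μ : Measure ℝ}

/-! ## §1 Integrability of polynomials and the bilinear pairing -/

/-- If all moments of `μ` exist, every real polynomial is `μ`-integrable (CR Lemma 3.1: "the
expression `⟨p, q⟩` exists for any real polynomials"). [cite: CardonRoberts2006, Lemma 3.1 p. 58] -/
theorem integrable_eval (hmom : ∀ m : ℕ, Integrable (fun x : ℝ ↦ x ^ m) μ) (p : ℝ[X]) :
    Integrable (fun x : ℝ ↦ p.eval x) μ := by
  have h : (fun x : ℝ ↦ p.eval x) =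
      fun x ↦ ∑ i ∈ Finset.range (p.natDegree + 1), p.coeff i * x ^ i := by
    funext x; exact p.eval_eq_sum_range x
  rw [h]
  exact integrable_finsetSum _ fun i _ ↦ (hmom i).const_mul _

/-- `⟨p, q⟩ = ∫ (p q)(x) dμ`. [cite: CardonRoberts2006, (7) p. 58] -/
theorem inner_eq_integral_mul (p q : ℝ[X]) :
    cardonRobertsInner μ p q = ∫ x, (p * q).eval x ∂μ := by
  simp only [cardonRobertsInner, eval_mul]

/-- Symmetry `⟨p, q⟩ = ⟨q, p⟩`. [cite: CardonRoberts2006, (7) p. 58] -/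
theorem inner_comm (p q : ℝ[X]) : cardonRobertsInner μ p q = cardonRobertsInner μ q p := by
  simp only [cardonRobertsInner, mul_comm]

/-- Additivity in the first slot. [cite: CardonRoberts2006, Lemma 3.1 p. 58 ("The bilinearity is apparent")] -/
theorem inner_add_left (hmom : ∀ m : ℕ, Integrable (fun x : ℝ ↦ x ^ m) μ) (p₁ p₂ q : ℝ[X]) :
    cardonRobertsInner μ (p₁ + p₂) q = cardonRobertsInner μ p₁ q + cardonRobertsInner μ p₂ q := by
  rw [inner_eq_integral_mul, inner_eq_integral_mul, inner_eq_integral_mul, ← integral_add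
    (integrable_eval hmom _) (integrable_eval hmom _)]
  refine integral_congr_ae (Eventually.of_forall fun x ↦ ?_)
  simp only [add_mul, eval_add]

/-- Homogeneity in the first slot. [cite: CardonRoberts2006, Lemma 3.1 p. 58 ("The bilinearity is apparent")] -/
theorem inner_smul_left (c : ℝ) (p q : ℝ[X]) :
    cardonRobertsInner μ (c • p) q = c * cardonRobertsInner μ p q := by
  rw [inner_eq_integral_mul, inner_eq_integral_mul, ← integral_const_mul]
  refine integral_congr_ae (Eventually.of_forall fun x ↦ ?_)
  simp only [smul_mul_assoc, eval_smul, smul_eq_mul]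

/-- `⟨0, q⟩ = 0`. [cite: CardonRoberts2006, Lemma 3.1 p. 58 (bilinearity of (7))] -/
theorem inner_zero_left (q : ℝ[X]) : cardonRobertsInner μ 0 q = 0 := by
  simp [cardonRobertsInner]

/-- `⟨−p, q⟩ = −⟨p, q⟩`. [cite: CardonRoberts2006, Lemma 3.1 p. 58 (bilinearity of (7))] -/
theorem inner_neg_left (p q : ℝ[X]) :
    cardonRobertsInner μ (-p) q = -cardonRobertsInner μ p q := by
  rw [show -p = (-1 : ℝ) • p by simp, inner_smul_left, neg_one_mul]

/-- Subtraction in the first slot. [cite: CardonRoberts2006, Lemma 3.1 p. 58 (bilinearity of (7))] -/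
theorem inner_sub_left (hmom : ∀ m : ℕ, Integrable (fun x : ℝ ↦ x ^ m) μ) (p₁ p₂ q : ℝ[X]) :
    cardonRobertsInner μ (p₁ - p₂) q = cardonRobertsInner μ p₁ q - cardonRobertsInner μ p₂ q := by
  rw [sub_eq_add_neg, inner_add_left hmom, inner_neg_left, ← sub_eq_add_neg]

/-- Finite sums in the first slot. [cite: CardonRoberts2006, Lemma 3.1 p. 58 (bilinearity of (7))] -/
theorem inner_sum_left (hmom : ∀ m : ℕ, Integrable (fun x : ℝ ↦ x ^ m) μ) {ι : Type*}
    (s : Finset ι) (f : ι → ℝ[X]) (q : ℝ[X]) :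
    cardonRobertsInner μ (∑ i ∈ s, f i) q = ∑ i ∈ s, cardonRobertsInner μ (f i) q := by
  classical
  induction s using Finset.induction_on with
  | empty => simp [inner_zero_left]
  | insert i s hi ih => rw [Finset.sum_insert hi, Finset.sum_insert hi, inner_add_left hmom, ih]

/-- `⟨p q, r⟩ = ⟨p, q r⟩` (both are `∫ p q r dμ`). [cite: CardonRoberts2006, Lemma 3.1 p. 58 (bilinearity of (7))] -/
theorem inner_mul_left (p q r : ℝ[X]) :
    cardonRobertsInner μ (p * q) r = cardonRobertsInner μ p (q * r) := by
  rw [inner_eq_integral_mul, inner_eq_integral_mul, mul_assoc]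

/-! ## §2 Positivity -/

/-- `⟨p, p⟩ = ∫ p(x)² dμ ≥ 0`. [cite: CardonRoberts2006, Lemma 3.1 p. 58] -/
theorem inner_self_nonneg (p : ℝ[X]) : 0 ≤ cardonRobertsInner μ p p :=
  integral_nonneg fun _ ↦ mul_self_nonneg _

/-- A non-zero polynomial which is nonnegative `μ`-a.e. has positive integral, provided no non-zero
polynomial vanishes `μ`-a.e. (CR: "Because the measure `dF` has infinite support").
[cite: CardonRoberts2006, Lemma 3.1 p. 58 (proof)] -/
theorem integral_pos_of_nonneg_ae (hmom : ∀ m : ℕ, Integrable (fun x : ℝ ↦ x ^ m) μ)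
    (hae : ∀ p : ℝ[X], (fun x : ℝ ↦ p.eval x) =ᵐ[μ] 0 → p = 0) {g : ℝ[X]} (hg : g ≠ 0)
    (h0 : 0 ≤ᵐ[μ] fun x : ℝ ↦ g.eval x) : 0 < ∫ x, g.eval x ∂μ := by
  rw [integral_pos_iff_support_of_nonneg_ae h0 (integrable_eval hmom g), pos_iff_ne_zero]
  intro hsupp
  refine hg (hae g ?_)
  filter_upwards [measure_eq_zero_iff_ae_notMem.1 hsupp] with y hy
  simpa [Function.mem_support] using hy

/-- **Positive definiteness** (CR Lemma 3.1): `⟨p, p⟩ > 0` for `p ≠ 0`. [cite: CardonRoberts2006, Lemma 3.1 p. 58] -/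
theorem inner_self_pos (hmom : ∀ m : ℕ, Integrable (fun x : ℝ ↦ x ^ m) μ)
    (hae : ∀ p : ℝ[X], (fun x : ℝ ↦ p.eval x) =ᵐ[μ] 0 → p = 0) {p : ℝ[X]} (hp : p ≠ 0) :
    0 < cardonRobertsInner μ p p := by
  rw [inner_eq_integral_mul]
  exact integral_pos_of_nonneg_ae hmom hae (mul_ne_zero hp hp)
    (Eventually.of_forall fun x ↦ by simpa [eval_mul] using mul_self_nonneg (p.eval x))

/-- `⟨p, p⟩ = 0` forces `p = 0`. [cite: CardonRoberts2006, Lemma 3.1 p. 58] -/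
theorem eq_zero_of_inner_self_eq_zero (hmom : ∀ m : ℕ, Integrable (fun x : ℝ ↦ x ^ m) μ)
    (hae : ∀ p : ℝ[X], (fun x : ℝ ↦ p.eval x) =ᵐ[μ] 0 → p = 0) {p : ℝ[X]}
    (h : cardonRobertsInner μ p p = 0) : p = 0 := by
  by_contra hp
  exact (inner_self_pos hmom hae hp).ne' h

/-! ## §3 The Gram–Schmidt polynomials: degree and orthogonality -/

/-- `p_n` is monic of degree `n` (CR p. 56: "the degree of `p_n(x)` is `n`", leading term `xⁿ`).
[cite: CardonRoberts2006, §2 p. 56] -/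
theorem degree_eq_and_monic (μ : Measure ℝ) (n : ℕ) :
    (cardonRobertsPoly μ n).degree = n ∧ (cardonRobertsPoly μ n).Monic := by
  induction n using Nat.strong_induction_on with
  | _ n ih =>
    have hsum : (∑ k : Fin n,
        (cardonRobertsInner μ (X ^ n) (cardonRobertsPoly μ k) /
            cardonRobertsInner μ (cardonRobertsPoly μ k) (cardonRobertsPoly μ k)) •
          cardonRobertsPoly μ k).degree < n := by
      refine (degree_sum_le _ _).trans_lt ?_
      refine (Finset.sup_lt_iff (WithBot.bot_lt_coe n)).2 fun k _ ↦ ?_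
      refine (degree_smul_le _ _).trans_lt ?_
      rw [(ih k k.isLt).1]
      exact WithBot.coe_lt_coe.2 k.isLt
    have hX : (X ^ n : ℝ[X]).degree = n := degree_X_pow n
    rw [cardonRobertsPoly_eq]
    refine ⟨?_, (monic_X_pow n).sub_of_left (by rwa [hX])⟩
    rw [degree_sub_eq_left_of_degree_lt (by rwa [hX]), hX]

/-- `p_n` is monic. [cite: CardonRoberts2006, §2 p. 56] -/
theorem monic (μ : Measure ℝ) (n : ℕ) : (cardonRobertsPoly μ n).Monic :=
  (degree_eq_and_monic μ n).2

/-- `deg p_n = n`. [cite: CardonRoberts2006, §2 p. 56] -/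
theorem degree_eq (μ : Measure ℝ) (n : ℕ) : (cardonRobertsPoly μ n).degree = n :=
  (degree_eq_and_monic μ n).1

/-- `natDegree p_n = n`. [cite: CardonRoberts2006, §2 p. 56] -/
theorem natDegree_eq (μ : Measure ℝ) (n : ℕ) : (cardonRobertsPoly μ n).natDegree = n :=
  natDegree_eq_of_degree_eq_some (degree_eq μ n)

/-- `p_n ≠ 0`. [cite: CardonRoberts2006, §2 p. 56] -/
theorem ne_zero (μ : Measure ℝ) (n : ℕ) : cardonRobertsPoly μ n ≠ 0 := (monic μ n).ne_zero

/-- **Orthogonality of the Gram–Schmidt family**: `⟨p_n, p_k⟩ = 0` for `k < n` (CR p. 56,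
Gram–Schmidt "produces an orthogonal family"). [cite: CardonRoberts2006, §2 p. 56] -/
theorem inner_eq_zero_of_lt (hmom : ∀ m : ℕ, Integrable (fun x : ℝ ↦ x ^ m) μ)
    (hae : ∀ p : ℝ[X], (fun x : ℝ ↦ p.eval x) =ᵐ[μ] 0 → p = 0) {k n : ℕ} (hkn : k < n) :
    cardonRobertsInner μ (cardonRobertsPoly μ n) (cardonRobertsPoly μ k) = 0 := by
  induction n using Nat.strong_induction_on generalizing k with
  | _ n ih =>
    -- orthogonality below `n`, in both orders
    have horth : ∀ i j : ℕ, i < n → j < n → i ≠ j →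
        cardonRobertsInner μ (cardonRobertsPoly μ i) (cardonRobertsPoly μ j) = 0 := by
      intro i j hi hj hij
      rcases lt_or_gt_of_ne hij with h | h
      · rw [inner_comm]; exact ih j hj h
      · exact ih i hi h
    rw [cardonRobertsPoly_eq μ n, inner_sub_left hmom, inner_sum_left hmom]
    simp_rw [inner_smul_left]
    rw [Finset.sum_eq_single ⟨k, hkn⟩]
    · have hkk : cardonRobertsInner μ (cardonRobertsPoly μ k) (cardonRobertsPoly μ k) ≠ 0 :=
        (inner_self_pos hmom hae (ne_zero μ k)).ne'
      rw [div_mul_cancel₀ _ hkk, sub_self]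
    · intro j _ hj
      rw [horth j k j.isLt hkn (fun h ↦ hj (Fin.ext h)), mul_zero]
    · intro h; exact absurd (Finset.mem_univ _) h

/-- **`p_n` is orthogonal to every polynomial of degree `< n`** (the `p_k`, `k < n`, being monic of
degree `k`, span the polynomials of degree `< n`). [cite: CardonRoberts2006, §2 p. 56] -/
theorem inner_eq_zero_of_degree_lt (hmom : ∀ m : ℕ, Integrable (fun x : ℝ ↦ x ^ m) μ)
    (hae : ∀ p : ℝ[X], (fun x : ℝ ↦ p.eval x) =ᵐ[μ] 0 → p = 0) {n : ℕ} {q : ℝ[X]}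
    (hq : q.degree < n) : cardonRobertsInner μ (cardonRobertsPoly μ n) q = 0 := by
  -- induction on a bound `m ≤ n` for the degree of `q`
  suffices h : ∀ m : ℕ, m ≤ n → ∀ q : ℝ[X], q.degree < m →
      cardonRobertsInner μ (cardonRobertsPoly μ n) q = 0 from h n le_rfl q hq
  intro m
  induction m with
  | zero =>
    intro _ q hq
    have : q = 0 := by
      by_contra h
      rw [degree_eq_natDegree h] at hq
      exact absurd hq (by exact_mod_cast Nat.not_lt_zero _)
    rw [this, inner_comm, inner_zero_left]
  | succ m ih =>
    intro hmn q hq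
    by_cases hlt : q.degree < m
    · exact ih ((Nat.le_succ m).trans hmn) q hlt
    · -- `deg q = m`: subtract the leading multiple of `p_m`
      have hq0 : q ≠ 0 := by rintro rfl; simp at hlt
      have hdeg : q.degree = m := by
        apply le_antisymm (Order.le_of_lt_succ (by exact_mod_cast hq)) (not_lt.1 hlt)
      have hnat : q.natDegree = m := natDegree_eq_of_degree_eq_some hdeg
      set c : ℝ := q.leadingCoeff with hc
      have hc0 : c ≠ 0 := leadingCoeff_ne_zero.2 hq0
      set r : ℝ[X] := q - c • cardonRobertsPoly μ m with hr
      have hcdeg : (c • cardonRobertsPoly μ m).degree = m := by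
        rw [smul_eq_C_mul, degree_C_mul hc0, degree_eq]
      have hrdeg : r.degree < m := by
        rw [hr, ← hdeg]
        refine degree_sub_lt (by rw [hdeg, hcdeg]) hq0 ?_
        rw [smul_eq_C_mul, leadingCoeff_mul, leadingCoeff_C, (monic μ m).leadingCoeff, mul_one]
      have hmn' : m < n := Nat.lt_of_succ_le hmn
      have h1 : cardonRobertsInner μ (cardonRobertsPoly μ n) r = 0 :=
        ih hmn'.le r hrdeg
      have h2 : cardonRobertsInner μ (cardonRobertsPoly μ n) (c • cardonRobertsPoly μ m) = 0 := by
        rw [inner_comm, inner_smul_left, inner_comm, inner_eq_zero_of_lt hmom hae hmn', mul_zero]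
      have hq' : q = r + c • cardonRobertsPoly μ m := by rw [hr, sub_add_cancel]
      rw [hq', inner_comm, inner_add_left hmom, inner_comm, h1, inner_comm, h2, add_zero]

/-- **Uniqueness of the monic orthogonal polynomials** (Szegő §2.2): a monic polynomial of degree
`n` which is orthogonal to all polynomials of degree `< n` equals `p_n`.
[cite: CardonRoberts2006, §2 p. 56] -/
theorem eq_of_monic_of_orthogonal (hmom : ∀ m : ℕ, Integrable (fun x : ℝ ↦ x ^ m) μ)
    (hae : ∀ p : ℝ[X], (fun x : ℝ ↦ p.eval x) =ᵐ[μ] 0 → p = 0) {n : ℕ} {q : ℝ[X]}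
    (hmonic : q.Monic) (hdeg : q.natDegree = n)
    (horth : ∀ r : ℝ[X], r.degree < n → cardonRobertsInner μ q r = 0) :
    q = cardonRobertsPoly μ n := by
  set d : ℝ[X] := q - cardonRobertsPoly μ n with hd
  have hddeg : d.degree < n := by
    by_cases h : q = cardonRobertsPoly μ n
    · rw [hd, h, sub_self, degree_zero]; exact WithBot.bot_lt_coe n
    · have hqdeg : q.degree = (n : WithBot ℕ) := by rw [degree_eq_natDegree hmonic.ne_zero, hdeg]
      rw [hd, ← hqdeg]
      exact degree_sub_lt (by rw [hqdeg, degree_eq]) hmonic.ne_zero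
        (by rw [hmonic.leadingCoeff, (monic μ n).leadingCoeff])
  have hdd : cardonRobertsInner μ d d = 0 := by
    have : cardonRobertsInner μ d d =
        cardonRobertsInner μ q d - cardonRobertsInner μ (cardonRobertsPoly μ n) d := by
      rw [hd, inner_sub_left hmom]
    rw [this, horth d hddeg, inner_eq_zero_of_degree_lt hmom hae hddeg, sub_zero]
  have := eq_zero_of_inner_self_eq_zero hmom hae hdd
  rw [hd, sub_eq_zero] at this
  exact this

/-! ## §4 Parity under a symmetric measure -/

/-- For a measure symmetric under `x ↦ −x` (`∫ p(−x) dμ = ∫ p(x) dμ` for all polynomials `p`):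
`p_n(−X) = (−1)ⁿ p_n(X)` — "`p_{2n}(x)` is an even function while `p_{2n+1}(x)` is an odd
function". [cite: CardonRoberts2006, §1 p. 55 and §3 p. 60] -/
theorem comp_neg_X (hmom : ∀ m : ℕ, Integrable (fun x : ℝ ↦ x ^ m) μ)
    (hae : ∀ p : ℝ[X], (fun x : ℝ ↦ p.eval x) =ᵐ[μ] 0 → p = 0)
    (hsym : ∀ p : ℝ[X], ∫ x, p.eval (-x) ∂μ = ∫ x, p.eval x ∂μ) (n : ℕ) :
    (cardonRobertsPoly μ n).comp (-X) = ((-1 : ℝ) ^ n) • cardonRobertsPoly μ n := by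
  set q : ℝ[X] := ((-1 : ℝ) ^ n) • (cardonRobertsPoly μ n).comp (-X) with hq
  have hs : ((-1 : ℝ) ^ n) * (-1) ^ n = 1 := by rw [← mul_pow, neg_one_mul, neg_neg, one_pow]
  have hnat : ((cardonRobertsPoly μ n).comp (-X)).natDegree = n := by
    rw [natDegree_comp, natDegree_eq, natDegree_neg, natDegree_X, mul_one]
  have hlc : ((cardonRobertsPoly μ n).comp (-X)).leadingCoeff = (-1) ^ n := by
    rw [leadingCoeff_comp (by rw [natDegree_neg, natDegree_X]; exact one_ne_zero),
      (monic μ n).leadingCoeff, natDegree_eq, leadingCoeff_neg, leadingCoeff_X, one_mul]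
  have hpow0 : ((-1 : ℝ) ^ n) ≠ 0 := pow_ne_zero _ (by norm_num)
  have hqmonic : q.Monic := by
    rw [Monic, hq, smul_eq_C_mul, leadingCoeff_mul, leadingCoeff_C, hlc, hs]
  have hqdeg : q.natDegree = n := by
    rw [hq, smul_eq_C_mul, natDegree_C_mul hpow0, hnat]
  -- orthogonality of `q` to lower degrees, from the symmetry of `μ`
  have hqorth : ∀ r : ℝ[X], r.degree < n → cardonRobertsInner μ q r = 0 := by
    intro r hr
    rw [hq, inner_smul_left]
    suffices h : cardonRobertsInner μ ((cardonRobertsPoly μ n).comp (-X)) r = 0 by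
      rw [h, mul_zero]
    -- `∫ p_n(−x) r(x) dμ = ∫ p_n(x) r(−x) dμ = ⟨p_n, r(−X)⟩ = 0`
    have h1 := hsym (cardonRobertsPoly μ n * r.comp (-X))
    have e1 : (fun x : ℝ ↦ (cardonRobertsPoly μ n * r.comp (-X)).eval (-x)) =
        fun x ↦ ((cardonRobertsPoly μ n).comp (-X)).eval x * r.eval x := by
      funext x; simp [eval_comp]
    rw [e1] at h1
    have e2 : cardonRobertsInner μ ((cardonRobertsPoly μ n).comp (-X)) r =
        cardonRobertsInner μ (cardonRobertsPoly μ n) (r.comp (-X)) := by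
      simp only [cardonRobertsInner, h1, eval_mul]
    rw [e2]
    refine inner_eq_zero_of_degree_lt hmom hae (lt_of_le_of_lt ?_ hr)
    by_cases hr0 : r = 0
    · simp [hr0]
    · rw [degree_eq_natDegree hr0, degree_le_iff_coeff_zero]
      intro m hm
      have hm' : (r.comp (-X)).natDegree < m := by
        rw [natDegree_comp, natDegree_neg, natDegree_X, mul_one]; exact_mod_cast hm
      exact coeff_eq_zero_of_natDegree_lt hm'
  have hqe : q = cardonRobertsPoly μ n := eq_of_monic_of_orthogonal hmom hae hqmonic hqdeg hqorth
  -- unwind: `(−1)ⁿ • p_n(−X) = p_n` gives `p_n(−X) = (−1)ⁿ • p_n`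
  calc (cardonRobertsPoly μ n).comp (-X)
      = (((-1 : ℝ) ^ n) * (-1) ^ n) • (cardonRobertsPoly μ n).comp (-X) := by rw [hs, one_smul]
    _ = ((-1 : ℝ) ^ n) • q := by rw [hq, smul_smul]
    _ = ((-1 : ℝ) ^ n) • cardonRobertsPoly μ n := by rw [hqe]

/-- Parity at the level of values: `p_n(−x) = (−1)ⁿ p_n(x)` for a symmetric measure.
[cite: CardonRoberts2006, §1 p. 55 and §3 p. 60] -/
theorem eval_neg (hmom : ∀ m : ℕ, Integrable (fun x : ℝ ↦ x ^ m) μ)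
    (hae : ∀ p : ℝ[X], (fun x : ℝ ↦ p.eval x) =ᵐ[μ] 0 → p = 0)
    (hsym : ∀ p : ℝ[X], ∫ x, p.eval (-x) ∂μ = ∫ x, p.eval x ∂μ) (n : ℕ) (x : ℝ) :
    (cardonRobertsPoly μ n).eval (-x) = (-1) ^ n * (cardonRobertsPoly μ n).eval x := by
  have h := congrArg (fun p : ℝ[X] ↦ p.eval x) (comp_neg_X hmom hae hsym n)
  simpa [eval_comp] using h

/-- In particular an even-indexed polynomial is even, `p_{2n}(−x) = p_{2n}(x)`.
[cite: CardonRoberts2006, §1 p. 55] -/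
theorem eval_neg_two_mul (hmom : ∀ m : ℕ, Integrable (fun x : ℝ ↦ x ^ m) μ)
    (hae : ∀ p : ℝ[X], (fun x : ℝ ↦ p.eval x) =ᵐ[μ] 0 → p = 0)
    (hsym : ∀ p : ℝ[X], ∫ x, p.eval (-x) ∂μ = ∫ x, p.eval x ∂μ) (n : ℕ) (x : ℝ) :
    (cardonRobertsPoly μ (2 * n)).eval (-x) = (cardonRobertsPoly μ (2 * n)).eval x := by
  rw [eval_neg hmom hae hsym, pow_mul, neg_one_sq, one_pow, one_mul]

/-- … and an odd-indexed polynomial is odd, `p_{2n+1}(−x) = −p_{2n+1}(x)`; hence `p_{2n+1}(0) = 0`.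
[cite: CardonRoberts2006, §1 p. 55] -/
theorem eval_neg_two_mul_add_one (hmom : ∀ m : ℕ, Integrable (fun x : ℝ ↦ x ^ m) μ)
    (hae : ∀ p : ℝ[X], (fun x : ℝ ↦ p.eval x) =ᵐ[μ] 0 → p = 0)
    (hsym : ∀ p : ℝ[X], ∫ x, p.eval (-x) ∂μ = ∫ x, p.eval x ∂μ) (n : ℕ) (x : ℝ) :
    (cardonRobertsPoly μ (2 * n + 1)).eval (-x) = -(cardonRobertsPoly μ (2 * n + 1)).eval x := by
  rw [eval_neg hmom hae hsym, pow_succ, pow_mul, neg_one_sq, one_pow, one_mul, neg_one_mul]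

/-- `p_{2n+1}(0) = 0` for a symmetric measure. [cite: CardonRoberts2006, §1 p. 55] -/
theorem eval_zero_odd (hmom : ∀ m : ℕ, Integrable (fun x : ℝ ↦ x ^ m) μ)
    (hae : ∀ p : ℝ[X], (fun x : ℝ ↦ p.eval x) =ᵐ[μ] 0 → p = 0)
    (hsym : ∀ p : ℝ[X], ∫ x, p.eval (-x) ∂μ = ∫ x, p.eval x ∂μ) (n : ℕ) :
    (cardonRobertsPoly μ (2 * n + 1)).eval 0 = 0 := by
  have h := eval_neg_two_mul_add_one hmom hae hsym n 0
  rw [neg_zero] at h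
  linarith

end CardonRobertsOP

end Literature.NumberTheory.LFunctions

end
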